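import Summits.AtomisticToContinuum.Crystallization.Theorems.FrustratedLawDichotomyStrainedPatchHomCurvLJLeaf
import Summits.AtomisticToContinuum.Crystallization.Theorems.FrustratedLawDichotomyStrainedPatchHomForceRing

/-!
# The centred LJ force-Jacobian leaf CHAINED into hand-2's ring lemmas: exterior force bound and slab confinement `T″` from ONE Boolean

decomp-a2c hand-1 g28 (crux `AperiodicFrustratedLawGap`, stmt-AtomisticToContinuum-27623; `(H) HomFloor (1/625)`, hcp half; critic rows 1099/1102/1103:
«production kernel = hand-1's centred `curvCheckLJ` once its K-file passes c = 0.85 at 2⁻¹¹; clone `hcpForceLJ_slab_of_checkN` as `…_of_checkLJ` from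
`curvLJ_floor_of_check` through `hcpForceLJ_slab_confinement` (segGd/profile currency)»).

* ★★★ `hcpForceLJ_exterior_of_checkLJ`, ★★★ `hcpForceLJ_slab_of_checkLJ` — the 2-line chains (`…HomCurvLJLeaf.curvLJ_floor_of_check` ⟶
  `…HomForceRing.hcpForceLJ_exterior` / `hcpForceLJ_slab_confinement`), same binders as hand-2's `…_of_checkN` (the K-file gate at the critic's cell
  `2⁻¹¹ × ξ .00125` is `…HomCurvLJGate.curvLamLJ_corner_gate`).

NO definitions; 0 sorry; standard axioms; no instances / notation / `#eval`.  `--supports stmt-AtomisticToContinuum-27623`.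
-/

noncomputable section

namespace Summit.AtomisticToContinuum.Crystallization.Theorems.FrustratedLawDichotomyStrainedPatchHomCurvLJ

open scoped BigOperators RealInnerProductSpace
open Literature.Analysis.ValidatedNumerics.Numerics
open Summit.AtomisticToContinuum.Crystallization.Theorems.ChargedEnergyGapNegative (E3)
open Summit.AtomisticToContinuum.Crystallization.Theorems.FrustratedLawDichotomyStrainedPatchHomSplit (latPt hexFrame hcpShift)
open Summit.AtomisticToContinuum.Crystallization.Theorems.FrustratedLawDichotomyStrainedPatchHomForceRing
  (hcpForceLJ_exterior hcpForceLJ_slab_confinement)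

/-! ## §1. Kernel Boolean ⟶ ring lemmas -/

/-- ★★★ **EXTERIOR FORCE BOUND FROM `curvCheckLJ`** (centred LJ force-Jacobian floor on the box ⟹ `(λ‖Δ‖ − f₀)‖Δ‖ ≤ Σ_b (‖X_b‖⁻⁸ − ‖X_b‖⁻¹⁴)⟪X_b, Δ⟫`
at the target shuffle). [folklore chaining] -/
theorem hcpForceLJ_exterior_of_checkLJ {c w : (Fin 3 × Fin 3) ⊕ Fin 3 → ℤ} {Lc Ln : List (Fin 3 → ℤ)} (hL : (Lc ++ Ln).Nodup) {lamS : ℤ}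
    (h : curvCheckLJ c w Lc Ln lamS = true) {U : E3 →L[ℝ] E3} (hU : ‖U - 1‖ ≤ 1 / 4)
    (hbox : ∀ ab : Fin 3 × Fin 3, |(U (EuclideanSpace.single ab.2 (1 : ℝ))) ab.1 - (c (Sum.inl ab) : ℝ) / SC| ≤ (w (Sum.inl ab) : ℝ) / SC)
    {ξ₀ ξ : E3} (hξ₀ : ∀ i : Fin 3, |ξ₀ i - (c (Sum.inr i) : ℝ) / SC| ≤ (w (Sum.inr i) : ℝ) / SC)
    (hξ : ∀ i : Fin 3, |ξ i - (c (Sum.inr i) : ℝ) / SC| ≤ (w (Sum.inr i) : ℝ) / SC) (hn₀ : ‖ξ₀‖ ≤ 1 / 4) (hn : ‖ξ‖ ≤ 1 / 4) {f₀ : ℝ}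
    (hf₀ : |∑ bb ∈ (Lc ++ Ln).toFinset, (‖latPt U hexFrame bb + U (hcpShift + ξ₀)‖⁻¹ ^ 8 - ‖latPt U hexFrame bb + U (hcpShift + ξ₀)‖⁻¹ ^ 14) *
        ⟪latPt U hexFrame bb + U (hcpShift + ξ₀), U (ξ - ξ₀)⟫| ≤ f₀ * ‖U (ξ - ξ₀)‖) :
    ((lamS : ℝ) / SC * ‖U (ξ - ξ₀)‖ - f₀) * ‖U (ξ - ξ₀)‖ ≤
      ∑ bb ∈ (Lc ++ Ln).toFinset, (‖latPt U hexFrame bb + U (hcpShift + ξ)‖⁻¹ ^ 8 - ‖latPt U hexFrame bb + U (hcpShift + ξ)‖⁻¹ ^ 14) *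
        ⟪latPt U hexFrame bb + U (hcpShift + ξ), U (ξ - ξ₀)⟫ :=
  hcpForceLJ_exterior (Lc ++ Ln).toFinset hU hn₀ hn (fun _ hs => curvLJ_floor_of_check hL h U hU hbox ξ₀ ξ hξ₀ hξ hn₀ hn hs) hf₀

/-- ★★★ **SLAB CONFINEMENT `T″` FROM `curvCheckLJ`**: reference bound `f₀`, target cap `σ` ⟹ `(lamS/SC)‖U(ξ−ξ₀)‖ ≤ σ + f₀` and
`(lamS/SC)·(3/4)‖ξ − ξ₀‖ ≤ σ + f₀` (if `0 ≤ lamS/SC`). [folklore chaining] -/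
theorem hcpForceLJ_slab_of_checkLJ {c w : (Fin 3 × Fin 3) ⊕ Fin 3 → ℤ} {Lc Ln : List (Fin 3 → ℤ)} (hL : (Lc ++ Ln).Nodup) {lamS : ℤ}
    (h : curvCheckLJ c w Lc Ln lamS = true) {U : E3 →L[ℝ] E3} (hU : ‖U - 1‖ ≤ 1 / 4)
    (hbox : ∀ ab : Fin 3 × Fin 3, |(U (EuclideanSpace.single ab.2 (1 : ℝ))) ab.1 - (c (Sum.inl ab) : ℝ) / SC| ≤ (w (Sum.inl ab) : ℝ) / SC)
    {ξ₀ ξ : E3} (hξ₀ : ∀ i : Fin 3, |ξ₀ i - (c (Sum.inr i) : ℝ) / SC| ≤ (w (Sum.inr i) : ℝ) / SC)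
    (hξ : ∀ i : Fin 3, |ξ i - (c (Sum.inr i) : ℝ) / SC| ≤ (w (Sum.inr i) : ℝ) / SC) (hn₀ : ‖ξ₀‖ ≤ 1 / 4) (hn : ‖ξ‖ ≤ 1 / 4)
    (hΔ : U (ξ - ξ₀) ≠ 0) {f₀ σ : ℝ}
    (hf₀ : |∑ bb ∈ (Lc ++ Ln).toFinset, (‖latPt U hexFrame bb + U (hcpShift + ξ₀)‖⁻¹ ^ 8 - ‖latPt U hexFrame bb + U (hcpShift + ξ₀)‖⁻¹ ^ 14) *
        ⟪latPt U hexFrame bb + U (hcpShift + ξ₀), U (ξ - ξ₀)⟫| ≤ f₀ * ‖U (ξ - ξ₀)‖)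
    (hσ : ∑ bb ∈ (Lc ++ Ln).toFinset, (‖latPt U hexFrame bb + U (hcpShift + ξ)‖⁻¹ ^ 8 - ‖latPt U hexFrame bb + U (hcpShift + ξ)‖⁻¹ ^ 14) *
        ⟪latPt U hexFrame bb + U (hcpShift + ξ), U (ξ - ξ₀)⟫ ≤ σ * ‖U (ξ - ξ₀)‖) :
    (lamS : ℝ) / SC * ‖U (ξ - ξ₀)‖ ≤ σ + f₀ ∧ (0 ≤ (lamS : ℝ) / SC → (lamS : ℝ) / SC * (3 / 4 * ‖ξ - ξ₀‖) ≤ σ + f₀) :=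
  hcpForceLJ_slab_confinement (Lc ++ Ln).toFinset hU hn₀ hn hΔ (fun _ hs => curvLJ_floor_of_check hL h U hU hbox ξ₀ ξ hξ₀ hξ hn₀ hn hs) hf₀ hσ

end Summit.AtomisticToContinuum.Crystallization.Theorems.FrustratedLawDichotomyStrainedPatchHomCurvLJ

end
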